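import Summits.KontsevichZagierPeriods.KontsevichZagierPeriods.Theorems.LinRedNormalFormArrangementNormalFormStubRebaseSimplePosOnePosHURatio

/-!
# Stub `stub_rebaseSimplePosOnePos` (crux `ArrangementNormalForm`, line `janus-bands`) —
part `HUDirs`: the re-selection directions at a triple point, dictionary (`B = 2`)

Towards the residue `HU` of the one-fibre rebase over the base `(x₁, x₂, y)`; see part
`HUChoice` for the choice itself. This file: the avoidance lemmas (`RebasePos.exists_large_avoid`,
`exists_small_avoid`: finitely many non-trivial affine conditions `αₖ + βₖ t ≠ 0` hold for some
rational `t > 1`, resp. `t ∈ (0, 1)`), the directions `RebasePos.dirQ (σ₀, −σ₁ q, ν)` and the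
`y`-component `RebasePos.nuQ` making a level invariant, the dictionary `∂_d` / `evQ` of the lifted
silent factors, the pole form and the resultants along `dirQ` at `P₀ = (X, Y)`, and the fact that
a far–far pair of silent factors whose resultant vanishes for every slope is a pair of
PROPORTIONAL letters (`RebasePos.smul_eq_of_brackets`, registered as
`rebaseSimplePos_smulEqOfBrackets`), which the separation engine never splits.

References: M. Kontsevich, D. Zagier, *Periods* (2001), §1.2.
-/

noncomputable section

open Set MeasureTheory MvPolynomial
open Literature.NumberTheory.Transcendental Literature.ModelTheory.ExponentialFields

namespace Summit.KontsevichZagierPeriods.ArrangementNormalForm.JanusBands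

namespace RebasePos

open SeparatePos

section Avoid

/-- Finitely many non-trivial affine conditions `αₖ + βₖ q ≠ 0` hold for some rational `q > 1`. -/
theorem exists_large_avoid {ι : Type*} [Fintype ι] (α β : ι → ℚ) (h : ∀ k, α k ≠ 0 ∨ β k ≠ 0) :
    ∃ q : ℚ, 1 < q ∧ ∀ k, α k + β k * q ≠ 0 := by
  classical
  have hS : 0 ≤ ∑ k, |α k / β k| := Finset.sum_nonneg fun k _ => abs_nonneg _
  refine ⟨2 + ∑ k, |α k / β k|, by linarith, fun k hk => ?_⟩
  by_cases hb : β k = 0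
  · rw [hb, zero_mul, add_zero] at hk
    exact (h k).elim (fun ha => ha hk) (fun hb' => hb' hb)
  · have hle : |α k / β k| ≤ ∑ k, |α k / β k| :=
      Finset.single_le_sum (f := fun k => |α k / β k|) (fun k _ => abs_nonneg _) (Finset.mem_univ k)
    have heq : α k / β k = -(2 + ∑ k, |α k / β k|) := by
      rw [eq_neg_iff_add_eq_zero, div_add' _ _ _ hb, div_eq_zero_iff]
      exact Or.inl (by linear_combination hk)
    have := neg_abs_le (α k / β k)
    linarith

/-- Finitely many non-trivial affine conditions `αₖ + βₖ θ ≠ 0` hold for some rational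
`θ ∈ (0, 1)`. -/
theorem exists_small_avoid {ι : Type*} [Fintype ι] (α β : ι → ℚ) (h : ∀ k, α k ≠ 0 ∨ β k ≠ 0) :
    ∃ θ : ℚ, 0 < θ ∧ θ < 1 ∧ ∀ k, α k + β k * θ ≠ 0 := by
  obtain ⟨T, hT, hTk⟩ := exists_large_avoid β α fun k => (h k).symm
  have hT0 : 0 < T := by linarith
  refine ⟨T⁻¹, inv_pos.2 hT0, inv_lt_one_of_one_lt₀ hT, fun k hk => hTk k ?_⟩
  have : (α k + β k * T⁻¹) * T = β k + α k * T := by field_simp; ring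
  rw [← this, hk, zero_mul]

end Avoid

section Dirs

variable {m : ℕ}

/-- The re-selection direction of the quadrant `(σ₀, σ₁)`: `(σ₀, −σ₁ q, ν)`. -/
def dirQ (σ₀ σ₁ q ν : ℚ) : Fin (2 + 1) → ℚ := ![σ₀, -(σ₁ * q), ν]

/-- The `y`-component of the direction making the level `u + θ (v − u)` invariant:
`ν = −(∂u + θ ∂(v − u))/u_y` (silent parts along `(σ₀, −σ₁ q)`). -/
def nuQ (u v : (Fin (2 + 1) → ℚ) × ℚ) (σ₀ σ₁ q θ : ℚ) : ℚ :=
  -((u.1 0 * σ₀ - u.1 1 * (σ₁ * q)) + θ * ((v - u).1 0 * σ₀ - (v - u).1 1 * (σ₁ * q))) / u.1 2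

/-- `∂_d` along `dirQ`. -/
theorem dd_dirQ (c : (Fin (2 + 1) → ℚ) × ℚ) (σ₀ σ₁ q ν : ℚ) :
    dd c (dirQ σ₀ σ₁ q ν) = c.1 0 * σ₀ - c.1 1 * (σ₁ * q) + c.1 2 * ν := by
  simp [dd, dirQ, Fin.sum_univ_three]
  ring

/-- The last component of `dirQ` is `ν`. -/
theorem dirQ_last (σ₀ σ₁ q ν : ℚ) : dirQ σ₀ σ₁ q ν (Fin.last 2) = ν := rfl

/-- `∂_d` of a lifted silent factor along `dirQ`. -/
theorem dd_liftX_dirQ (c : (Fin 2 → ℚ) × ℚ) (σ₀ σ₁ q ν : ℚ) :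
    dd (liftX c) (dirQ σ₀ σ₁ q ν) = c.1 0 * σ₀ - c.1 1 * (σ₁ * q) := by
  rw [dd_liftX]
  simp [dirQ]
  ring

/-- `∂_d` of the pole form along `dirQ`. -/
theorem dd_poleX_dirQ (ℓ : (Fin 2 → ℚ) × ℚ) (σ₀ σ₁ q ν : ℚ) :
    dd (poleX ℓ) (dirQ σ₀ σ₁ q ν) = -(ℓ.1 0 * σ₀) + ℓ.1 1 * (σ₁ * q) + ν := by
  rw [dd_dirQ]
  have h0 : (poleX ℓ).1 0 = -ℓ.1 0 := poleX_fst_castSucc ℓ 0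
  have h1 : (poleX ℓ).1 1 = -ℓ.1 1 := poleX_fst_castSucc ℓ 1
  have h2 : (poleX ℓ).1 2 = 1 := poleX_fst_last ℓ
  rw [h0, h1, h2]
  ring

/-- `evQ` is linear: subtraction. -/
theorem evQ_sub (c c' : (Fin (2 + 1) → ℚ) × ℚ) (P : Fin (2 + 1) → ℚ) : evQ (c - c') P = evQ c P - evQ c' P := by
  simp only [evQ, Prod.fst_sub, Prod.snd_sub, Pi.sub_apply, sub_mul, Finset.sum_sub_distrib]
  ring

/-- `evQ` is linear: scalars. -/
theorem evQ_smul (t : ℚ) (c : (Fin (2 + 1) → ℚ) × ℚ) (P : Fin (2 + 1) → ℚ) : evQ (t • c) P = t * evQ c P := by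
  simp only [evQ, Prod.smul_fst, Prod.smul_snd, Pi.smul_apply, smul_eq_mul, mul_add, Finset.mul_sum, mul_assoc]

/-- The value of a resultant form at a point. -/
theorem evQ_resF (c c' : (Fin (2 + 1) → ℚ) × ℚ) (d P : Fin (2 + 1) → ℚ) :
    evQ (resF c c' d) P = dd c d * evQ c' P - dd c' d * evQ c P := by
  rw [resF, evQ_sub, evQ_smul, evQ_smul]

/-- Components of a vector of length three. -/
theorem vec3_zero (a b c : ℚ) : (![a, b, c] : Fin (2 + 1) → ℚ) 0 = a := rfl

/-- Components of a vector of length three. -/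
theorem vec3_one (a b c : ℚ) : (![a, b, c] : Fin (2 + 1) → ℚ) 1 = b := rfl

/-- Components of a vector of length three. -/
theorem vec3_two (a b c : ℚ) : (![a, b, c] : Fin (2 + 1) → ℚ) 2 = c := rfl

/-- The value of a lifted silent factor at `P₀ = (X, Y)`. -/
theorem evQ_liftX (c : (Fin 2 → ℚ) × ℚ) (X : Fin 2 → ℚ) (Y : ℚ) : evQ (liftX c) ![X 0, X 1, Y] = valX c X := by
  rw [evQ, Fin.sum_univ_three]
  have h0 : (liftX c).1 0 = c.1 0 := liftX_fst_castSucc c 0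
  have h1 : (liftX c).1 1 = c.1 1 := liftX_fst_castSucc c 1
  have h2 : (liftX c).1 2 = 0 := liftX_fst_last c
  rw [h0, h1, h2, show (liftX c).2 = c.2 from rfl, vec3_zero, vec3_one, zero_mul, add_zero, valX]

/-- The value of the pole form at `P₀ = (X, Y)`. -/
theorem evQ_poleX (ℓ : (Fin 2 → ℚ) × ℚ) (X : Fin 2 → ℚ) (Y : ℚ) : evQ (poleX ℓ) ![X 0, X 1, Y] = Y - valX ℓ X := by
  rw [evQ, Fin.sum_univ_three]
  have h0 : (poleX ℓ).1 0 = -ℓ.1 0 := poleX_fst_castSucc ℓ 0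
  have h1 : (poleX ℓ).1 1 = -ℓ.1 1 := poleX_fst_castSucc ℓ 1
  have h2 : (poleX ℓ).1 2 = 1 := poleX_fst_last ℓ
  rw [h0, h1, h2, show (poleX ℓ).2 = -ℓ.2 from rfl, vec3_zero, vec3_one, vec3_two, valX]
  ring

/-- `liftX` is linear. -/
theorem liftX_smul (t : ℚ) (c : (Fin 2 → ℚ) × ℚ) : liftX (t • c) = t • liftX c := by
  refine Prod.ext (funext fun i => ?_) rfl
  refine Fin.lastCases ?_ (fun i => ?_) i
  · simp only [Prod.smul_fst, Pi.smul_apply, liftX_fst_last, smul_zero]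
  · simp only [Prod.smul_fst, Pi.smul_apply, liftX_fst_castSucc]

/-- A lifted silent factor with non-zero linear part has a non-zero `x'`-gradient. -/
theorem grad_ne_of_liftX (c : (Fin 2 → ℚ) × ℚ) (h : (liftX c).1 ≠ 0) : c.1 0 ≠ 0 ∨ c.1 1 ≠ 0 := by
  by_contra hc
  push Not at hc
  refine h (funext fun i => ?_)
  refine Fin.lastCases ?_ (fun i => ?_) i
  · exact liftX_fst_last c
  · rw [liftX_fst_castSucc]
    fin_cases i
    · exact hc.1
    · exact hc.2

/-- **Degenerate far–far pairs are proportional**: if both brackets of the far–far resultant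
vanish, the two weighted letters coincide along every direction (so the engine never splits
the pair). -/
theorem smul_eq_of_brackets (c c' : (Fin 2 → ℚ) × ℚ) (X : Fin 2 → ℚ) (hc' : valX c' X ≠ 0)
    (h0 : c.1 0 * valX c' X = c'.1 0 * valX c X) (h1 : c.1 1 * valX c' X = c'.1 1 * valX c X)
    (d : Fin (2 + 1) → ℚ) : dd (liftX c') d • liftX c = dd (liftX c) d • liftX c' := by
  set t : ℚ := valX c X / valX c' X with ht
  have hct : c = t • c' := by
    refine Prod.ext (funext fun i => ?_) ?_
    · rw [Prod.smul_fst, Pi.smul_apply, smul_eq_mul, ht]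
      fin_cases i
      · show c.1 0 = valX c X / valX c' X * c'.1 0
        field_simp
        linear_combination h0
      · show c.1 1 = valX c X / valX c' X * c'.1 1
        field_simp
        linear_combination h1
    · rw [Prod.smul_snd, smul_eq_mul, ht]
      have e1 : c.2 = valX c X - c.1 0 * X 0 - c.1 1 * X 1 := by rw [valX]; ring
      have e2 : c'.2 = valX c' X - c'.1 0 * X 0 - c'.1 1 * X 1 := by rw [valX]; ring
      rw [e1, e2]
      field_simp
      linear_combination -(X 0) * h0 - X 1 * h1
  rw [hct, liftX_smul, dd_smul, smul_smul, mul_comm]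

end Dirs

end RebasePos

/-- **Registered part of `stub_rebaseSimplePosOnePos` (line `janus-bands`): degenerate far–far
pairs are proportional** (`RebasePos.smul_eq_of_brackets`): two silent factors `c`, `c'` far from
the point `X` (`c'(X) ≠ 0`) whose two resultant brackets vanish define the same weighted letter
along every direction `d`: `∂_d c' · c = ∂_d c · c'`. -/
theorem rebaseSimplePos_smulEqOfBrackets (c c' : (Fin 2 → ℚ) × ℚ) (X : Fin 2 → ℚ) (hc' : RebasePos.valX c' X ≠ 0) (h0 : c.1 0 * RebasePos.valX c' X = c'.1 0 * RebasePos.valX c X) (h1 : c.1 1 * RebasePos.valX c' X = c'.1 1 * RebasePos.valX c X) (d : Fin (2 + 1) → ℚ) : RebasePos.dd (RebasePos.liftX c') d • RebasePos.liftX c = RebasePos.dd (RebasePos.liftX c) d • RebasePos.liftX c' :=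
  RebasePos.smul_eq_of_brackets c c' X hc' h0 h1 d

end Summit.KontsevichZagierPeriods.ArrangementNormalForm.JanusBands
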